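import Literature.RingTheory.HilbertSamuel.TangentConeDimension
import Mathlib.LinearAlgebra.LinearIndependent.BaseChange
import Mathlib.FieldTheory.IsAlgClosed.AlgebraicClosure
import Mathlib.RingTheory.IntegralClosure.IsIntegralClosure.Basic
import HarnessLib

/-!
# Hilbert functions are invariant under extension of the base field; `dim C(𝒪) = dim 𝒪` for
# every noetherian local ring

Topic: `Literature/RingTheory/HilbertSamuel`. CJS, LNM 2270, Rem. 2.12 (a): "Obviously, for any
field extension `K/k` we have `H^{(0)}(A_K) = H^{(0)}(A)`" for a standard graded `k`-algebra `A`.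
For `A = k[X_1, …, X_e]/J`, `J` homogeneous, and a field homomorphism `ι : k → K`:

* `isHomogeneous_map` — `J · K[X]` is homogeneous;
* **`idealDegree_map_eq_span`** — `(J · K[X])_t` is the `K`-span of `ι(J_t)`;
* `finrank_span_image_eq` — `dim_K span_K ι(V) = dim_k V` for a subspace `V ⊆ k[X]_t` (`k`-linearly
  independent polynomials stay `K`-linearly independent: coefficientwise, Mathlib
  `linearIndependent_algebraMap_comp_iff`);
* **`hilbertFunQuot_map`** — **`H(K[X]/J K[X]) = H(k[X]/J)`** (CJS Rem. 2.12 (a));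
* `ringKrullDim_quotient_map_le_of_isIntegral` — for `K/k` algebraic,
  `dim K[X]/J K[X] ≤ dim k[X]/J` (integrality, `Literature.RingTheory.KrullDimension.ringKrullDim_eq_of_isIntegral`).

Application (CJS p. 26 "`dim C(𝒪) = dim 𝒪`"; Matsumura Thm. 13.9), removing the hypothesis
"infinite residue field" from `TangentConeDimension.lean`:

* **`ringKrullDim_quotient_tangentConeIdeal_eq`** — for EVERY noetherian local ring `A` and
  generators `x_1, …, x_e` of `𝔪`, `dim k[X_1, …, X_e]/J = dim A` for the tangent cone ideal `J`
  (`k[X]/J ≅ gr_𝔪(A)`): pass to an algebraic closure `K` of `k`, where `H(J K[X]) = H(J) ≥ Φ^{(dim A)}`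
  forces `dim K[X]/J K[X] ≥ dim A` (`Literature.RingTheory.MvPolynomial.hilbert_le_mul_pow`), and
  `dim K[X]/J K[X] ≤ dim k[X]/J ≤ dim A`.

## References

* V. Cossart, U. Jannsen, S. Saito, *Desingularization: Invariants and Strategy*, LNM 2270
  (2020), Ch. 2, Rem. 2.12 (a), p. 26. [CossartJannsenSaito2020]
* H. Matsumura, *Commutative Ring Theory* (1986), Thm. 13.9. [Matsumura1987]
-/

noncomputable section

open IsLocalRing Finset MvPolynomial
open Literature.RingTheory.MvPolynomial Literature.RingTheory.KrullDimension

namespace Literature.RingTheory.HilbertSamuel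

universe u

section FieldExtension

variable {k K : Type*} [Field k] [Field K] (ι : k →+* K) {e : ℕ}

/-! ## Homogeneity of the extended ideal -/

/-- **`J · K[X]` is homogeneous** for a homogeneous ideal `J ⊆ k[X]` (it is spanned by the images
of the homogeneous elements of `J`, which are homogeneous; via Mathlib's `Ideal.IsHomogeneous` for
the grading by degree). [folklore] -/
theorem isHomogeneousIdeal_map {J : Ideal (MvPolynomial (Fin e) k)} (hJ : IsHomogeneousIdeal J) :
    IsHomogeneousIdeal (J.map (MvPolynomial.map ι)) := by
  letI := MvPolynomial.gradedAlgebra (σ := Fin e) (R := k)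
  letI := MvPolynomial.gradedAlgebra (σ := Fin e) (R := K)
  rw [isHomogeneousIdeal_iff] at hJ ⊢
  obtain ⟨S, rfl⟩ := (Ideal.IsHomogeneous.iff_exists _ _).mp hJ
  rw [Ideal.map_span]
  refine Ideal.homogeneous_span _ _ ?_
  rintro _ ⟨_, ⟨s, hs, rfl⟩, rfl⟩
  obtain ⟨i, hi⟩ := s.2
  exact ⟨i, (hi : (s : MvPolynomial (Fin e) k).IsHomogeneous i).map ι⟩

/-! ## The graded pieces of the extended ideal -/

/-- `span_K ι(J_t) ⊆ (J K[X])_t`. [folklore] -/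
theorem span_image_idealDegree_le (J : Ideal (MvPolynomial (Fin e) k)) (t : ℕ) :
    Submodule.span K (MvPolynomial.map ι '' (idealDegree J t : Set (MvPolynomial (Fin e) k))) ≤
      idealDegree (J.map (MvPolynomial.map ι)) t := by
  rw [Submodule.span_le]
  rintro _ ⟨g, hg, rfl⟩
  exact ⟨Ideal.mem_map_of_mem _ hg.1, (mem_homogeneousSubmodule _ _).mp hg.2 |>.map ι⟩

/-- `span_K ι(J_t)` consists of forms of degree `t`. [folklore] -/
theorem span_image_idealDegree_le_homogeneousSubmodule (J : Ideal (MvPolynomial (Fin e) k)) (t : ℕ) :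
    Submodule.span K (MvPolynomial.map ι '' (idealDegree J t : Set (MvPolynomial (Fin e) k))) ≤
      homogeneousSubmodule (Fin e) K t := by
  rw [Submodule.span_le]
  rintro _ ⟨g, hg, rfl⟩
  exact ((mem_homogeneousSubmodule _ _).mp hg.2).map ι

/-- `X_l · span_K ι(J_t) ⊆ span_K ι(J_{t+1})`. [folklore] -/
theorem X_mul_mem_span_image_idealDegree (J : Ideal (MvPolynomial (Fin e) k)) {t : ℕ}
    {f : MvPolynomial (Fin e) K}
    (hf : f ∈ Submodule.span K (MvPolynomial.map ι '' (idealDegree J t : Set (MvPolynomial (Fin e) k))))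
    (l : Fin e) :
    X l * f ∈ Submodule.span K (MvPolynomial.map ι '' (idealDegree J (t + 1) : Set (MvPolynomial (Fin e) k))) := by
  induction hf using Submodule.span_induction with
  | mem w hw =>
    obtain ⟨g, hg, rfl⟩ := hw
    refine Submodule.subset_span ⟨X l * g, ⟨J.mul_mem_left _ hg.1, ?_⟩, by rw [map_mul, map_X]⟩
    rw [add_comm]
    exact (isHomogeneous_X k l).mul hg.2
  | zero => rw [mul_zero]; exact zero_mem _
  | add p q _ _ hp hq => rw [mul_add]; exact add_mem hp hq
  | smul a p _ hp => rw [mul_smul_comm]; exact Submodule.smul_mem _ a hp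

/-- The homogeneous components of `s · f` lie in the `span_K ι(J_d)` when those of `f` do
(induction on `s`). [folklore] -/
theorem homogeneousComponent_mul_mem_span_image (J : Ideal (MvPolynomial (Fin e) k))
    {f : MvPolynomial (Fin e) K} (hf : ∀ d, homogeneousComponent d f ∈
      Submodule.span K (MvPolynomial.map ι '' (idealDegree J d : Set (MvPolynomial (Fin e) k))))
    (s : MvPolynomial (Fin e) K) (d : ℕ) :
    homogeneousComponent d (s * f) ∈
      Submodule.span K (MvPolynomial.map ι '' (idealDegree J d : Set (MvPolynomial (Fin e) k))) := by
  induction s using MvPolynomial.induction_on generalizing f d with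
  | C a =>
    rw [C_mul', map_smul]
    exact Submodule.smul_mem _ a (hf d)
  | add p q hp hq =>
    rw [add_mul, map_add]
    exact add_mem (hp hf d) (hq hf d)
  | mul_X p l hp =>
    rw [mul_assoc]
    refine hp (fun d' => ?_) d
    -- components of `X_l · f`
    have hXf : X l * f =
        ∑ i ∈ Finset.range (f.totalDegree + 1), X l * homogeneousComponent i f := by
      rw [← Finset.mul_sum, sum_homogeneousComponent]
    rw [hXf, map_sum]
    refine Submodule.sum_mem _ fun i _ => ?_
    have hmem : X l * homogeneousComponent i f ∈
        Submodule.span K (MvPolynomial.map ι '' (idealDegree J (i + 1) : Set (MvPolynomial (Fin e) k))) :=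
      X_mul_mem_span_image_idealDegree ι J (hf i) l
    rw [homogeneousComponent_of_mem (span_image_idealDegree_le_homogeneousSubmodule ι J (i + 1) hmem)]
    split_ifs with h
    · subst h
      exact hmem
    · exact zero_mem _

/-- **The homogeneous components of every element of `J · K[X]` lie in the `span_K ι(J_d)`**, for
`J` homogeneous. [folklore] -/
theorem homogeneousComponent_mem_span_image {J : Ideal (MvPolynomial (Fin e) k)}
    (hJ : IsHomogeneousIdeal J) {f : MvPolynomial (Fin e) K}
    (hf : f ∈ J.map (MvPolynomial.map ι)) (d : ℕ) :
    homogeneousComponent d f ∈ Submodule.span K (MvPolynomial.map ι '' (idealDegree J d : Set (MvPolynomial (Fin e) k))) := by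
  rw [Ideal.map, Ideal.span] at hf
  induction hf using Submodule.span_induction generalizing d with
  | mem w hw =>
    obtain ⟨g, hg, rfl⟩ := hw
    rw [← map_homogeneousComponent]
    exact Submodule.subset_span ⟨_, ⟨hJ g hg d, homogeneousComponent_mem d g⟩, rfl⟩
  | zero =>
    rw [map_zero]
    exact zero_mem _
  | add p q _ _ hp hq =>
    rw [map_add]
    exact add_mem (hp d) (hq d)
  | smul s p _ hp =>
    rw [smul_eq_mul]
    exact homogeneousComponent_mul_mem_span_image ι J hp s d

/-- **`(J · K[X])_t = span_K ι(J_t)`** for a homogeneous ideal `J ⊆ k[X]` (as sets; the left side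
is a `K`-subspace through `restrictScalars`). [cite: CossartJannsenSaito2020, Rem. 2.12 (a)] -/
theorem idealDegree_map_eq_span {J : Ideal (MvPolynomial (Fin e) k)} (hJ : IsHomogeneousIdeal J)
    (t : ℕ) :
    idealDegree (J.map (MvPolynomial.map ι)) t =
      Submodule.span K (MvPolynomial.map ι '' (idealDegree J t : Set (MvPolynomial (Fin e) k))) := by
  refine le_antisymm (fun f hf => ?_) (span_image_idealDegree_le ι J t)
  have h := homogeneousComponent_mem_span_image ι hJ hf.1 t
  rwa [homogeneousComponent_eq_self hf.2] at h

/-! ## Dimensions are preserved -/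

/-- **`dim_K span_K ι(V) = dim_k V`** for a subspace `V ⊆ k[X]_t` of forms of degree `t`: a
`k`-basis of `V` maps to a `K`-linearly independent spanning family (independence is read off the
coefficient vectors, Mathlib `linearIndependent_algebraMap_comp_iff`). [folklore] -/
theorem finrank_span_image_eq {t : ℕ} (V : Submodule k (MvPolynomial (Fin e) k))
    (hV : V ≤ homogeneousSubmodule (Fin e) k t) [FiniteDimensional k V] :
    Module.finrank K (Submodule.span K (MvPolynomial.map ι '' (V : Set (MvPolynomial (Fin e) k)))) =
      Module.finrank k V := by
  set W := Submodule.span K (MvPolynomial.map ι '' (V : Set (MvPolynomial (Fin e) k))) with hW_def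
  let b := Module.Basis.ofVectorSpace k V
  set I := Module.Basis.ofVectorSpaceIndex k V
  haveI : Finite I := Module.Finite.finite_basis b
  letI : Fintype I := Fintype.ofFinite I
  -- `W` is spanned by the images of the basis vectors
  have hspan : W = Submodule.span K
      (Set.range fun i : I => MvPolynomial.map ι (b i : MvPolynomial (Fin e) k)) := by
    refine le_antisymm (Submodule.span_le.mpr ?_) (Submodule.span_mono ?_)
    · rintro _ ⟨v, hv, rfl⟩
      have hv' : (⟨v, hv⟩ : V) ∈ Submodule.span k (Set.range b) := by rw [b.span_eq]; trivial
      rw [show v = V.subtype ⟨v, hv⟩ from rfl]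
      refine Submodule.span_induction ?_ ?_ ?_ ?_ hv'
      · rintro _ ⟨i, rfl⟩
        exact Submodule.subset_span ⟨i, rfl⟩
      · rw [map_zero, map_zero]
        exact zero_mem _
      · intro p q _ _ hp hq
        rw [map_add, map_add]
        exact add_mem hp hq
      · intro a p _ hp
        rw [map_smul, Submodule.coe_subtype, MvPolynomial.smul_eq_C_mul, map_mul, map_C,
          ← MvPolynomial.smul_eq_C_mul]
        exact Submodule.smul_mem _ _ hp
    · rintro _ ⟨i, rfl⟩
      exact ⟨b i, (b i).2, rfl⟩
  -- and they are `K`-linearly independent: read off the coefficient vectors on the monomials of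
  -- degree `t` (finitely many), on which forms of degree `t` are determined
  let cdk : MvPolynomial (Fin e) k →ₗ[k] monomialsOfDegree e t → k :=
    LinearMap.pi fun m : monomialsOfDegree e t => lcoeff k m.1
  let cdK : MvPolynomial (Fin e) K →ₗ[K] monomialsOfDegree e t → K :=
    LinearMap.pi fun m : monomialsOfDegree e t => lcoeff K m.1
  have hcdk : ∀ (p : MvPolynomial (Fin e) k) (m : monomialsOfDegree e t), cdk p m = coeff m.1 p :=
    fun p m => rfl
  have hcdK : ∀ (p : MvPolynomial (Fin e) K) (m : monomialsOfDegree e t), cdK p m = coeff m.1 p :=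
    fun p m => rfl
  have hinjOn : Set.InjOn cdk (homogeneousSubmodule (Fin e) k t : Set (MvPolynomial (Fin e) k)) := by
    intro p hp q hq h
    ext m
    by_cases hm : m.degree = t
    · have := congrFun h ⟨m, hm⟩
      rwa [hcdk, hcdk] at this
    · rw [((mem_homogeneousSubmodule _ _).mp hp).coeff_eq_zero hm,
        ((mem_homogeneousSubmodule _ _).mp hq).coeff_eq_zero hm]
  have hinj : Set.InjOn cdk
      (↑(Submodule.span k (Set.range (V.subtype ∘ b))) : Set (MvPolynomial (Fin e) k)) := by
    refine hinjOn.mono ?_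
    refine SetLike.coe_subset_coe.mpr ((Submodule.span_le.mpr ?_).trans hV)
    rintro _ ⟨i, rfl⟩
    exact (b i).2
  have h1 : LinearIndependent k fun i : I => cdk (b i : MvPolynomial (Fin e) k) :=
    (b.linearIndependent.map' V.subtype (Submodule.ker_subtype _)).map_injOn cdk hinj
  letI : Algebra k K := ι.toAlgebra
  have h2 := (linearIndependent_algebraMap_comp_iff (S := K)).mpr h1
  have hli : LinearIndependent K fun i : I => MvPolynomial.map ι (b i : MvPolynomial (Fin e) k) := by
    refine LinearIndependent.of_comp cdK ?_
    have hfun : (⇑cdK ∘ fun i : I => MvPolynomial.map ι (b i : MvPolynomial (Fin e) k)) =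
        fun i : I => (algebraMap k K) ∘ cdk (b i : MvPolynomial (Fin e) k) := by
      funext i m
      rw [Function.comp_apply, hcdK, Function.comp_apply, hcdk]
      exact coeff_map ι _ m.1
    rw [hfun]
    exact h2
  rw [hspan, finrank_span_eq_card hli, ← Module.finrank_eq_card_basis b]

/-- **`dim_K (J · K[X])_t = dim_k J_t`** for a homogeneous ideal `J`. [cite: CossartJannsenSaito2020, Rem. 2.12 (a)] -/
theorem finrank_idealDegree_map {J : Ideal (MvPolynomial (Fin e) k)} (hJ : IsHomogeneousIdeal J)
    (t : ℕ) :
    Module.finrank K (idealDegree (J.map (MvPolynomial.map ι)) t) =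
      Module.finrank k (idealDegree J t) := by
  rw [idealDegree_map_eq_span ι hJ t]
  exact finrank_span_image_eq ι (idealDegree J t) inf_le_right

/-- **`H(K[X]/J K[X]) = H(k[X]/J)`: the Hilbert function of a standard graded algebra is invariant
under extension of the base field** (CJS Rem. 2.12 (a): "for any field extension `K/k` we have
`H^{(0)}(A_K) = H^{(0)}(A)`"). [cite: CossartJannsenSaito2020, Rem. 2.12 (a)] -/
theorem hilbertFunQuot_map {J : Ideal (MvPolynomial (Fin e) k)} (hJ : IsHomogeneousIdeal J) :
    hilbertFunQuot K e (J.map (MvPolynomial.map ι)) = hilbertFunQuot k e J := by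
  classical
  funext t
  rw [hilbertFunQuot, hilbertFunQuot, finrank_idealDegree_map ι hJ t,
    finrank_homogeneousSubmodule_eq_card, finrank_homogeneousSubmodule_eq_card]

end FieldExtension

/-! ## Algebraic extensions do not raise the dimension -/

section Algebraic

variable {k K : Type*} [Field k] [Field K] [Algebra k K] {e : ℕ}

/-- **`dim K[X]/J K[X] ≤ dim k[X]/J` for `K/k` algebraic**: `K[X]/J K[X]` is integral over
`k[X]/(J K[X] ∩ k[X])`, a quotient of `k[X]/J`. (Equality holds — `J K[X] ∩ k[X] = J` by faithful
flatness — but is not needed here.) [cite: Matsumura1987, Thm 9.4] -/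
theorem ringKrullDim_quotient_map_le_of_isIntegral [Algebra.IsIntegral k K]
    (J : Ideal (MvPolynomial (Fin e) k)) :
    ringKrullDim (MvPolynomial (Fin e) K ⧸ J.map (MvPolynomial.map (algebraMap k K))) ≤
      ringKrullDim (MvPolynomial (Fin e) k ⧸ J) := by
  letI := MvPolynomial.algebraMvPolynomial (σ := Fin e) (R := k) (S := K)
  set JK : Ideal (MvPolynomial (Fin e) K) :=
    J.map (algebraMap (MvPolynomial (Fin e) k) (MvPolynomial (Fin e) K)) with hJK
  have hJK' : J.map (MvPolynomial.map (algebraMap k K)) = JK := by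
    rw [hJK, MvPolynomial.algebraMap_def]
  rw [hJK']
  have h1 : ringKrullDim (MvPolynomial (Fin e) k ⧸ JK.comap (algebraMap _ _)) =
      ringKrullDim (MvPolynomial (Fin e) K ⧸ JK) :=
    ringKrullDim_eq_of_isIntegral Ideal.algebraMap_quotient_injective
  rw [← h1]
  exact ringKrullDim_le_of_surjective (Ideal.Quotient.factor Ideal.le_comap_map)
    (Ideal.Quotient.factor_surjective _)

end Algebraic

/-! ## `dim C(𝒪) = dim 𝒪` for every noetherian local ring -/

section Local

variable {A : Type u} [CommRing A] [IsLocalRing A] [IsNoetherianRing A] {e : ℕ} (x : Fin e → A)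
  (hx : Ideal.span (Set.range x) = maximalIdeal A)

/-- **`dim C(𝒪) = dim 𝒪`** (CJS p. 26; Matsumura Thm. 13.9 `dim A = dim gr_𝔪 A`) for EVERY
noetherian local ring: `dim k[X_1, …, X_e]/J = dim A` for the tangent cone ideal `J` of generators
`x_1, …, x_e` of `𝔪` (`k[X]/J ≅ gr_𝔪(A)` degreewise). Proof: `≤` is
`ringKrullDim_quotient_tangentConeIdeal_le`; for `≥`, over an algebraic closure `K` of `k` the ideal
`J K[X]` has the same Hilbert function `H(J) = H^{(0)}_A ≥ Φ^{(dim A)}`, so `dim K[X]/J K[X] ≥ dim A`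
by the polynomial bound `H ≤ C (t+1)^{dim - 1}` over the infinite field `K`, while
`dim K[X]/J K[X] ≤ dim k[X]/J`. [cite: Matsumura1987, Thm. 13.9] -/
theorem ringKrullDim_quotient_tangentConeIdeal_eq :
    ringKrullDim (MvPolynomial (Fin e) (ResidueField A) ⧸ tangentConeIdeal x hx) = ringKrullDim A := by
  refine le_antisymm (ringKrullDim_quotient_tangentConeIdeal_le x hx) ?_
  obtain ⟨d, hd⟩ : ∃ d : ℕ, ringKrullDim A = d :=
    exists_nat_eq_of_ne_bot_of_ne_top ringKrullDim_ne_bot ringKrullDim_ne_top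
  set k := ResidueField A
  let K := AlgebraicClosure k
  set J := tangentConeIdeal x hx
  set JK : Ideal (MvPolynomial (Fin e) K) := J.map (MvPolynomial.map (algebraMap k K)) with hJK_def
  have hJ : IsHomogeneousIdeal J := isHomogeneousIdeal_tangentConeIdeal x hx
  have hJK := (isHomogeneousIdeal_iff _).mp (isHomogeneousIdeal_map (algebraMap k K) hJ)
  -- `H(JK) = H(J) = H⁽⁰⁾_A ≥ Φ^{(d)}`
  have hH : hilbertFunQuot K e JK = hilbertFun A := by
    rw [hJK_def, hilbertFunQuot_map (algebraMap k K) hJ, hilbertFunQuot_tangentConeIdeal x hx]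
  have hlow : iterPSum d Phi ≤ hilbertFunQuot K e JK := by
    rw [hH]
    exact iterPSum_Phi_le_hilbertFun hd
  -- `dim K[X]/JK = n ∈ ℕ`
  haveI : Nontrivial (MvPolynomial (Fin e) K ⧸ JK) := by
    refine Ideal.Quotient.nontrivial_iff.mpr fun htop => ?_
    have h0 := congrFun hH 0
    rw [hilbertFun_zero, htop] at h0
    unfold hilbertFunQuot at h0
    have h1 : idealDegree (⊤ : Ideal (MvPolynomial (Fin e) K)) 0 = homogeneousSubmodule (Fin e) K 0 := by
      ext f
      simp
    rw [h1, Nat.sub_self] at h0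
    exact zero_ne_one h0
  obtain ⟨n, hn⟩ : ∃ n : ℕ, ringKrullDim (MvPolynomial (Fin e) K ⧸ JK) = n := by
    refine exists_nat_eq_of_ne_bot_of_ne_top ?_ ?_
    · exact ne_bot_of_le_ne_bot WithBot.zero_ne_bot ringKrullDim_nonneg_of_nontrivial
    · refine ne_top_of_le_ne_top ?_ (ringKrullDim_quotient_le _)
      rw [ringKrullDim_mvPolynomial_fin]
      intro h
      exact ENat.coe_ne_top e (WithBot.coe_eq_top.mp ((WithBot.coe_natCast e).trans h))
  -- `d ≤ n`
  have hdn : d ≤ n := by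
    cases n with
    | zero =>
      -- `H(JK; t) = 0` for `t ≫ 0`, so `Φ^{(d)}` vanishes eventually: `d = 0`
      obtain ⟨t₁, ht₁⟩ := hilbert_eq_zero_of_X_pow_mem
        (exists_X_pow_mem_of_ringKrullDim_le_zero hJK (by rw [hn]; rfl))
      rcases Nat.eq_zero_or_pos d with hd0 | hd0
      · exact hd0.le
      · exfalso
        have hpos : 0 < iterPSum d Phi t₁ := iterPSum_Phi_pos hd0 t₁
        have hle : iterPSum d Phi t₁ ≤ 0 := by
          have h := hlow t₁
          unfold hilbertFunQuot at h
          rwa [ht₁ t₁ le_rfl] at h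
        exact Nat.lt_irrefl 0 (hpos.trans_le hle)
    | succ b =>
      obtain ⟨C, hC⟩ := hilbert_le_mul_pow b JK hJK hn.le
      apply le_of_iterPSum_Phi_le_smul (m := C * b.factorial)
      intro t
      rw [Pi.smul_apply, smul_eq_mul]
      calc iterPSum d Phi t ≤ hilbertFunQuot K e JK t := hlow t
        _ ≤ C * (t + 1) ^ b := hC t
        _ ≤ C * (b.factorial * iterPSum (b + 1) Phi t) :=
            Nat.mul_le_mul_left C (pow_le_factorial_mul_iterPSum_Phi b t)
        _ = C * b.factorial * iterPSum (b + 1) Phi t := (mul_assoc _ _ _).symm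
  -- `n ≤ dim k[X]/J`
  have hnle : (n : WithBot ℕ∞) ≤ ringKrullDim (MvPolynomial (Fin e) k ⧸ J) := by
    rw [← hn, hJK_def]
    exact ringKrullDim_quotient_map_le_of_isIntegral J
  rw [hd]
  exact le_trans (by exact_mod_cast hdn) hnle

omit x in
/-- **CJS Lemma 2.14 (c) for local rings / `dim A` is read off `H^{(0)}_A`**: two noetherian local
rings with the same Hilbert function have the same dimension (`dim A = dim k[X]/J` and
`dim k[X]/J` is determined by `H(k[X]/J) = H^{(0)}_A` through CJS Lemma 2.25 (a) with `a = 0`).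
[cite: CossartJannsenSaito2020, Lemma 2.25 (a)] -/
theorem ringKrullDim_eq_of_hilbertFun_eq {A' : Type*} [CommRing A'] [IsLocalRing A']
    [IsNoetherianRing A'] (h : hilbertFun A = hilbertFun A') : ringKrullDim A = ringKrullDim A' := by
  obtain ⟨d, hd⟩ : ∃ d : ℕ, ringKrullDim A = d :=
    exists_nat_eq_of_ne_bot_of_ne_top ringKrullDim_ne_bot ringKrullDim_ne_top
  obtain ⟨d', hd'⟩ : ∃ d' : ℕ, ringKrullDim A' = d' :=
    exists_nat_eq_of_ne_bot_of_ne_top ringKrullDim_ne_bot ringKrullDim_ne_top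
  have h1 : d' ≤ d := (le_dim_iff_iterPSum_Phi_le A hd d' 0).mpr (by
    rw [Nat.add_zero, hilbertSamuelFun_zero, h]
    exact iterPSum_Phi_le_hilbertFun hd')
  have h2 : d ≤ d' := (le_dim_iff_iterPSum_Phi_le A' hd' d 0).mpr (by
    rw [Nat.add_zero, hilbertSamuelFun_zero, ← h]
    exact iterPSum_Phi_le_hilbertFun hd)
  rw [hd, hd', le_antisymm h2 h1]

end Local

end Literature.RingTheory.HilbertSamuel

end
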